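import Mathlib
import Literature.NumberTheory.Sieve.CoprimeSquarefreeSums
import HarnessLib

/-!
# Partial summation against a smooth weight: Maynard 2015, Lemma 6.1 (dimension `κ = 1`)

Topic `Literature/NumberTheory/Sieve`; sequel of `CoprimeSquarefreeSums.lean`. J. Maynard,
*Small gaps between primes*, Ann. of Math. 181 (2015), Lemma 6.1 (quoted from
Goldston–Graham–Pintz–Yıldırım, Proc. LMS 98 (2009), Lemma 4): for a multiplicative `γ` of
dimension `κ` and a piecewise differentiable `G` on `[0,1]`,
`Σ_{d<z} μ(d)² g(d) G(log d/log z) = 𝔖 (log z)^κ/Γ(κ) ∫₀¹ G(x) x^{κ−1} dx + O(𝔖 L G_max (log z)^{κ−1})`.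
Maynard applies it only with `κ = 1` (Lemmas 6.2, 6.3: `γ(p) = 1` or `1 + 1/(p²−p−1)` off the
primes dividing `W`). This file PROVES the `κ = 1` case for the family of weights
`w_c(n)/n = μ²(n) 𝟙_{(n,W)=1} ∏_{p∣n}(1 + c_p)/n` of `CoprimeSquarefreeSums.lean` (`|c_p| ≤ C₀/p`;
`c_p = 1/(p−1)` is `μ²/φ`, `c_p = 1/(p−2)` is `μ² φ/(g · id)` with `g(p) = p − 2`), for `C¹`
weights `G`:

* `abs_sum_wfun_smooth_sub_le`:
  `|Σ_{n ≤ z} (w_c(n)/n) G(log n/log z) − (φ(W)/W) log z ∫₀¹ G| ≤ (M₀ + M₁)(K + (φ(W)/W) η log z)`,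
  `|G| ≤ M₀`, `|G'| ≤ M₁` on `[0,1]`, `K = (harmErr W + 4) B(C₀)`, `η = B(C₀) D₀^{-1/4}` when every
  prime `≤ D₀` divides `W` — Maynard's `𝔖 log z ∫₀¹ G + O(𝔖 L G_max)` with `𝔖 = φ(W)/W`, except
  for the extra relative error `η = o(1)` (`D₀ → ∞`) inherited from the elementary evaluation of the
  singular series in `CoprimeSquarefreeSums`;
* the ingredients: Abel summation (Mathlib's `sum_mul_eq_sub_integral_mul₀`) against
  `T(t) = Σ_{n≤t} w_c(n)/n = (φ(W)/W) log t + O(K + (φ(W)/W) η log t)`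
  (`abs_sum_wfun_div_sub_log_le`), the identity `∫₁ᶻ G'(log t/log z) log t dt/(t log z) =
  log z (G(1) − ∫₀¹ G)` (integration by parts and `integral_comp_log_div`, the substitution
  `s = log t/log z`), and `∫₁ᶻ dt/(t log z) = 1`.

## References

* J. Maynard, *Small gaps between primes*, Ann. of Math. (2) 181 (2015), 383–413, Lemma 6.1 and
  its use in Lemmas 6.2–6.3. [cite: MaynardAnnals2015]
* D. A. Goldston, S. W. Graham, J. Pintz, C. Y. Yıldırım, *Small gaps between products of two
  primes*, Proc. London Math. Soc. (3) 98 (2009), 741–774, Lemma 4. [folklore]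
-/

open Finset Real ArithmeticFunction MeasureTheory Set

open scoped ArithmeticFunction.Moebius

namespace Literature.NumberTheory.Sieve

namespace SquarefreeSums

variable {W : ℕ} {c : ℕ → ℝ}

/-- The step function `T(t) = Σ_{n ≤ t} w_c(n)/n` and its deviation `r(t) = T(t) − (φ(W)/W) log t`:
for `t ≥ 1`, `|r(t)| ≤ K + (φ(W)/W) η log t` with `K = (harmErr W + 4) B(C₀)` and
`η = B(C₀) D₀^{-1/4}` (from `abs_sum_wfun_div_sub_le`, `abs_bsum_sub_one_le`). [folklore] -/
theorem abs_sum_wfun_div_sub_log_le (hW : W ≠ 0) {C₀ : ℝ} (hc : ∀ p, p.Prime → |c p| ≤ C₀ / p)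
    {D₀ : ℕ} (hD0 : 1 ≤ D₀) (hD : ∀ p, p.Prime → p ≤ D₀ → p ∣ W) {t : ℝ} (ht : 1 ≤ t) :
    |∑ n ∈ Icc 1 ⌊t⌋₊, wfun W c n / n - (W.totient : ℝ) / W * Real.log t| ≤
      (harmErr W + 4) * bConst C₀ +
        (W.totient : ℝ) / W * (bConst C₀ * (D₀ : ℝ) ^ (-(1 : ℝ) / 4)) * Real.log t := by
  have h1 := abs_sum_wfun_div_sub_le hW hc ht
  have h2 := abs_bsum_sub_one_le (W := W) (c := c) hc hD0 hD ht
  have hlog : 0 ≤ Real.log t := Real.log_nonneg ht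
  have hA : 0 ≤ (W.totient : ℝ) / W := by positivity
  calc |∑ n ∈ Icc 1 ⌊t⌋₊, wfun W c n / n - (W.totient : ℝ) / W * Real.log t|
      = |(∑ n ∈ Icc 1 ⌊t⌋₊, wfun W c n / n - (W.totient : ℝ) / W * bsum W c t * Real.log t) +
          (W.totient : ℝ) / W * (bsum W c t - 1) * Real.log t| := by ring_nf
    _ ≤ |∑ n ∈ Icc 1 ⌊t⌋₊, wfun W c n / n - (W.totient : ℝ) / W * bsum W c t * Real.log t| +
          |(W.totient : ℝ) / W * (bsum W c t - 1) * Real.log t| := abs_add_le _ _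
    _ ≤ _ := by
        refine add_le_add h1 ?_
        rw [abs_mul, abs_mul, abs_of_nonneg hA, abs_of_nonneg hlog]
        gcongr


/-- `∫₁ᶻ G(log t/log z) dt/t = log z ∫₀¹ G` (substitution `s = log t/log z`). [folklore] -/
theorem integral_comp_log_div (G : ℝ → ℝ) (hGc : Continuous G) {z : ℝ} (hz : 1 < z) :
    ∫ t in (1 : ℝ)..z, G (Real.log t / Real.log z) * (t⁻¹ / Real.log z) = ∫ s in (0 : ℝ)..1, G s := by
  have hL : 0 < Real.log z := Real.log_pos hz
  have hderiv : ∀ t ∈ uIcc (1 : ℝ) z, HasDerivAt (fun t => Real.log t / Real.log z) (t⁻¹ / Real.log z) t := by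
    intro t ht
    rw [uIcc_of_le hz.le] at ht
    have ht0 : t ≠ 0 := by linarith [ht.1]
    exact (Real.hasDerivAt_log ht0).div_const _
  have hcont : ContinuousOn (fun t : ℝ => t⁻¹ / Real.log z) (uIcc (1 : ℝ) z) := by
    rw [uIcc_of_le hz.le]
    refine ContinuousOn.div_const (continuousOn_inv₀.mono fun t ht => ?_) _
    exact ne_of_gt (by linarith [ht.1] : (0 : ℝ) < t)
  have := intervalIntegral.integral_comp_mul_deriv' (g := G) hderiv hcont hGc.continuousOn
  simp only [Function.comp, Real.log_one, zero_div, div_self hL.ne'] at this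
  exact this

/-- **Maynard 2015, Lemma 6.1 with `κ = 1`** (the partial-summation lemma quoted from
Goldston–Graham–Pintz–Yıldırım, Lemma 4) for the weights `w_c(n)/n = μ²(n) 𝟙_{(n,W)=1} ∏_{p∣n}(1+c_p)/n`
of `CoprimeSquarefreeSums`: for `W ≥ 1`, `|c_p| ≤ C₀/p`, every prime `≤ D₀` dividing `W` (`D₀ ≥ 1`),
`G ∈ C¹` with `|G| ≤ M₀`, `|G'| ≤ M₁` on `[0,1]`, and `z > 1`,
`|Σ_{n ≤ z} (w_c(n)/n) G(log n/log z) − (φ(W)/W) log z ∫₀¹ G| ≤ (M₀ + M₁)(K + (φ(W)/W) η log z)`,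
`K = (harmErr W + 4) B(C₀)`, `η = B(C₀) D₀^{-1/4}` — Maynard's shape
`𝔖 (log z) ∫₀¹ G + O(𝔖 L G_max)` with `𝔖 = φ(W)/W`, up to the additional relative error `η`
(which is `o(1)` as `D₀ → ∞`). Proof: Abel summation (Mathlib's `sum_mul_eq_sub_integral_mul₀`)
against `T(t) = Σ_{n≤t} w_c(n)/n = (φ(W)/W) log t + O(K + (φ(W)/W) η log t)`, the identity
`∫₁ᶻ G'(log t/log z) log t dt/(t log z) = log z (G(1) − ∫₀¹ G)` (integration by parts and the
substitution `s = log t/log z`), and `∫₁ᶻ dt/(t log z) = 1`.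
[cite: MaynardAnnals2015, Lemma 6.1] -/
theorem abs_sum_wfun_smooth_sub_le (hW : W ≠ 0) {C₀ : ℝ} (hc : ∀ p, p.Prime → |c p| ≤ C₀ / p)
    {D₀ : ℕ} (hD0 : 1 ≤ D₀) (hD : ∀ p, p.Prime → p ≤ D₀ → p ∣ W)
    {G : ℝ → ℝ} (hG : ContDiff ℝ 1 G) {M₀ M₁ : ℝ}
    (hM0 : ∀ s ∈ Set.Icc (0 : ℝ) 1, |G s| ≤ M₀) (hM1 : ∀ s ∈ Set.Icc (0 : ℝ) 1, |deriv G s| ≤ M₁)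
    {z : ℝ} (hz : 1 < z) :
    |∑ n ∈ Icc 1 ⌊z⌋₊, wfun W c n / n * G (Real.log n / Real.log z) -
        (W.totient : ℝ) / W * Real.log z * ∫ s in (0 : ℝ)..1, G s| ≤
      (M₀ + M₁) * ((harmErr W + 4) * bConst C₀ +
        (W.totient : ℝ) / W * (bConst C₀ * (D₀ : ℝ) ^ (-(1 : ℝ) / 4)) * Real.log z) := by
  -- notation and basic facts
  have hL : 0 < Real.log z := Real.log_pos hz
  have hz0 : 0 < z := by linarith
  obtain ⟨A, hA⟩ : ∃ A : ℝ, A = (W.totient : ℝ) / W := ⟨_, rfl⟩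
  obtain ⟨ρ, hρ⟩ : ∃ ρ : ℝ, ρ = (harmErr W + 4) * bConst C₀ +
      (W.totient : ℝ) / W * (bConst C₀ * (D₀ : ℝ) ^ (-(1 : ℝ) / 4)) * Real.log z := ⟨_, rfl⟩
  have hGd : Differentiable ℝ G := hG.differentiable one_ne_zero
  have hG'c : Continuous (deriv G) := hG.continuous_deriv le_rfl
  have hGc : Continuous G := hG.continuous
  have hM0' : 0 ≤ M₀ := le_trans (abs_nonneg _) (hM0 0 ⟨le_rfl, zero_le_one⟩)
  have hM1' : 0 ≤ M₁ := le_trans (abs_nonneg _) (hM1 0 ⟨le_rfl, zero_le_one⟩)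
  -- the coefficients and the step function
  obtain ⟨cs, hcs⟩ : ∃ cs : ℕ → ℝ, cs = fun n => wfun W c n / n := ⟨_, rfl⟩
  have hcs0 : cs 0 = 0 := by rw [hcs]; simp
  obtain ⟨T, hT⟩ : ∃ T : ℝ → ℝ, T = fun t => ∑ k ∈ Icc 0 ⌊t⌋₊, cs k := ⟨_, rfl⟩
  have hT1 : ∀ t, T t = ∑ k ∈ Icc 1 ⌊t⌋₊, wfun W c k / k := by
    intro t
    rw [hT]
    dsimp only
    rw [Icc_eq_cons_Ioc (Nat.zero_le _), sum_cons, hcs0, zero_add, ← Finset.Icc_add_one_left_eq_Ioc, zero_add, hcs]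
  -- `r = T − A log` is small on `[1, z]`
  have hr : ∀ t ∈ Set.Icc (1 : ℝ) z, |T t - A * Real.log t| ≤ ρ := by
    intro t ht
    have h := abs_sum_wfun_div_sub_log_le hW hc hD0 hD ht.1
    rw [← hT1 t, ← hA] at h
    refine h.trans ?_
    rw [hρ, ← hA]
    have hlogt : Real.log t ≤ Real.log z := Real.log_le_log (by linarith [ht.1]) ht.2
    have : 0 ≤ A * (bConst C₀ * (D₀ : ℝ) ^ (-(1 : ℝ) / 4)) := by
      rw [hA]
      have hC₀ : 0 ≤ C₀ := by
        have := hc 2 Nat.prime_two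
        have h2 : (0 : ℝ) ≤ C₀ / 2 := le_trans (abs_nonneg _) this
        linarith
      have := one_le_bConst hC₀
      positivity
    nlinarith
  have hρ0 : 0 ≤ ρ := le_trans (abs_nonneg _) (hr 1 ⟨le_rfl, hz.le⟩)
  -- the smooth weight `f(t) = G(log t / log z)` and its derivative
  obtain ⟨f, hf⟩ : ∃ f : ℝ → ℝ, f = fun t => G (Real.log t / Real.log z) := ⟨_, rfl⟩
  obtain ⟨f', hf'⟩ : ∃ f' : ℝ → ℝ, f' = fun t => deriv G (Real.log t / Real.log z) * (t⁻¹ / Real.log z) :=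
    ⟨_, rfl⟩
  have hfd : ∀ t, 0 < t → HasDerivAt f (f' t) t := by
    intro t ht
    rw [hf, hf']
    have h1 : HasDerivAt (fun t => Real.log t / Real.log z) (t⁻¹ / Real.log z) t :=
      (Real.hasDerivAt_log ht.ne').div_const _
    exact (hGd _).hasDerivAt.comp t h1
  have hf'c : ContinuousOn f' (Set.Icc 1 z) := by
    rw [hf']
    refine ContinuousOn.mul ((hG'c.comp_continuousOn ((continuousOn_log.mono ?_).div_const _)))
      (ContinuousOn.div_const (continuousOn_inv₀.mono ?_) _)
    · intro t ht; exact ne_of_gt (by linarith [ht.1] : (0 : ℝ) < t)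
    · intro t ht; exact ne_of_gt (by linarith [ht.1] : (0 : ℝ) < t)
  have hderivf : ∀ t ∈ Set.Icc (1 : ℝ) z, deriv f t = f' t := fun t ht =>
    (hfd t (by linarith [ht.1])).deriv
  -- Abel summation
  have hAbel := sum_mul_eq_sub_integral_mul₀ cs hcs0 z (f := f)
    (fun t ht => (hfd t (by linarith [ht.1])).differentiableAt)
    ((hf'c.integrableOn_Icc).congr_fun (fun t ht => (hderivf t ht).symm) measurableSet_Icc)
  -- identify the pieces of Abel's formula
  have hLHS : ∑ k ∈ Icc 0 ⌊z⌋₊, f k * cs k =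
      ∑ n ∈ Icc 1 ⌊z⌋₊, wfun W c n / n * G (Real.log n / Real.log z) := by
    rw [Icc_eq_cons_Ioc (Nat.zero_le _), sum_cons, hcs0, mul_zero, zero_add,
      ← Finset.Icc_add_one_left_eq_Ioc, zero_add]
    refine Finset.sum_congr rfl fun n _ => ?_
    rw [hf, hcs, mul_comm]
  have hfz : f z = G 1 := by rw [hf]; simp [div_self hL.ne']
  have hint : ∫ t in Set.Ioc 1 z, deriv f t * ∑ k ∈ Icc 0 ⌊t⌋₊, cs k =
      ∫ t in (1 : ℝ)..z, f' t * T t := by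
    rw [intervalIntegral.integral_of_le hz.le, hT]
    refine setIntegral_congr_fun measurableSet_Ioc fun t ht => ?_
    rw [hderivf t ⟨ht.1.le, ht.2⟩]
  have hTz : ∑ k ∈ Icc 0 ⌊z⌋₊, cs k = T z := by rw [hT]
  rw [hLHS, hfz, hint, hTz] at hAbel
  -- hAbel : Σ = G 1 * T z - ∫ f' T
  -- the calculus identity `∫₁ᶻ f' log = log z (G 1 − ∫₀¹ G)`
  have hparts : ∫ t in (1 : ℝ)..z, f' t * Real.log t = Real.log z * (G 1 - ∫ s in (0 : ℝ)..1, G s) := by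
    have h1 : ∫ t in (1 : ℝ)..z, Real.log t * f' t =
        Real.log z * f z - Real.log 1 * f 1 - ∫ t in (1 : ℝ)..z, t⁻¹ * f t := by
      refine intervalIntegral.integral_mul_deriv_eq_deriv_mul (fun t ht => ?_) (fun t ht => ?_) ?_ ?_
      · rw [uIcc_of_le hz.le] at ht
        exact Real.hasDerivAt_log (by linarith [ht.1])
      · rw [uIcc_of_le hz.le] at ht
        exact hfd t (by linarith [ht.1])
      · refine ContinuousOn.intervalIntegrable ?_
        rw [uIcc_of_le hz.le]
        exact continuousOn_inv₀.mono fun t ht => ne_of_gt (by linarith [ht.1] : (0 : ℝ) < t)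
      · exact (hf'c.mono (by rw [uIcc_of_le hz.le])).intervalIntegrable
    have h2 : ∫ t in (1 : ℝ)..z, t⁻¹ * f t = Real.log z * ∫ s in (0 : ℝ)..1, G s := by
      rw [← integral_comp_log_div G hGc hz, ← intervalIntegral.integral_const_mul]
      refine intervalIntegral.integral_congr fun t _ => ?_
      rw [hf]
      field_simp
    calc ∫ t in (1 : ℝ)..z, f' t * Real.log t = ∫ t in (1 : ℝ)..z, Real.log t * f' t := by
          refine intervalIntegral.integral_congr fun t _ => ?_; ring
      _ = _ := by rw [h1, h2, hfz, Real.log_one]; ring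
  -- integrability facts on `[1, z]`
  have hf'T : IntervalIntegrable (fun t => f' t * T t) volume 1 z := by
    rw [intervalIntegrable_iff_integrableOn_Icc_of_le hz.le, hT]
    exact integrableOn_mul_sum_Icc cs zero_le_one hf'c.integrableOn_Icc
  have hf'log : IntervalIntegrable (fun t => f' t * Real.log t) volume 1 z := by
    refine (ContinuousOn.mul hf'c (continuousOn_log.mono fun t ht => ?_)).intervalIntegrable_of_Icc hz.le
    exact ne_of_gt (by linarith [ht.1] : (0 : ℝ) < t)
  -- the error integral `∫ f' r`, `r = T − A log`
  have hA' : IntervalIntegrable (fun t => A * (f' t * Real.log t)) volume 1 z := hf'log.const_mul A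
  have hR : IntervalIntegrable (fun t => f' t * (T t - A * Real.log t)) volume 1 z := by
    have := hf'T.sub hA'
    convert this using 1
    funext t
    ring
  have hsplit : ∫ t in (1 : ℝ)..z, f' t * T t =
      A * (∫ t in (1 : ℝ)..z, f' t * Real.log t) + ∫ t in (1 : ℝ)..z, f' t * (T t - A * Real.log t) := by
    rw [← intervalIntegral.integral_const_mul, ← intervalIntegral.integral_add hA' hR]
    refine intervalIntegral.integral_congr fun t _ => ?_
    ring
  have herr : |∫ t in (1 : ℝ)..z, f' t * (T t - A * Real.log t)| ≤ M₁ * ρ := by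
    have hbound : ∀ t ∈ Set.Icc (1 : ℝ) z, |f' t * (T t - A * Real.log t)| ≤ M₁ * ρ / Real.log z * t⁻¹ := by
      intro t ht
      have ht0 : 0 < t := by linarith [ht.1]
      have hs : Real.log t / Real.log z ∈ Set.Icc (0 : ℝ) 1 := by
        constructor
        · exact div_nonneg (Real.log_nonneg ht.1) hL.le
        · rw [div_le_one hL]; exact Real.log_le_log ht0 ht.2
      rw [abs_mul, hf']
      dsimp only
      rw [abs_mul, abs_of_pos (by positivity : (0 : ℝ) < t⁻¹ / Real.log z)]
      have e1 := hM1 _ hs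
      have e2 := hr t ht
      calc |deriv G (Real.log t / Real.log z)| * (t⁻¹ / Real.log z) * |T t - A * Real.log t|
          ≤ M₁ * (t⁻¹ / Real.log z) * ρ := by gcongr
        _ = M₁ * ρ / Real.log z * t⁻¹ := by ring
    have hii : IntervalIntegrable (fun t => f' t * (T t - A * Real.log t)) volume 1 z := hR
    calc |∫ t in (1 : ℝ)..z, f' t * (T t - A * Real.log t)|
        ≤ ∫ t in (1 : ℝ)..z, |f' t * (T t - A * Real.log t)| :=
          intervalIntegral.abs_integral_le_integral_abs hz.le
      _ ≤ ∫ t in (1 : ℝ)..z, M₁ * ρ / Real.log z * t⁻¹ := by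
          refine intervalIntegral.integral_mono_on hz.le hii.norm ?_ hbound
          refine ContinuousOn.intervalIntegrable_of_Icc hz.le ?_
          exact (continuousOn_inv₀.mono fun t ht => ne_of_gt (by linarith [ht.1] : (0 : ℝ) < t)).const_smul
            (M₁ * ρ / Real.log z) |>.congr fun t _ => by simp [smul_eq_mul]
      _ = M₁ * ρ := by
          rw [intervalIntegral.integral_const_mul, integral_inv_of_pos zero_lt_one hz0, div_one]
          field_simp
  -- assemble
  have hG1 : |G 1| ≤ M₀ := hM0 1 ⟨zero_le_one, le_rfl⟩
  have hrz : |T z - A * Real.log z| ≤ ρ := hr z ⟨hz.le, le_rfl⟩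
  have key : ∑ n ∈ Icc 1 ⌊z⌋₊, wfun W c n / n * G (Real.log n / Real.log z) -
      (W.totient : ℝ) / W * Real.log z * ∫ s in (0 : ℝ)..1, G s =
      G 1 * (T z - A * Real.log z) - ∫ t in (1 : ℝ)..z, f' t * (T t - A * Real.log t) := by
    rw [hAbel, hsplit, hparts, ← hA]
    ring
  rw [key, ← hρ]
  calc |G 1 * (T z - A * Real.log z) - ∫ t in (1 : ℝ)..z, f' t * (T t - A * Real.log t)|
      ≤ |G 1 * (T z - A * Real.log z)| + |∫ t in (1 : ℝ)..z, f' t * (T t - A * Real.log t)| := abs_sub _ _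
    _ ≤ M₀ * ρ + M₁ * ρ := by
        refine add_le_add ?_ herr
        rw [abs_mul]
        exact mul_le_mul hG1 hrz (abs_nonneg _) hM0'
    _ = (M₀ + M₁) * ρ := by ring

end SquarefreeSums

end Literature.NumberTheory.Sieve
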